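import Summits.QuantumFields.YangMills.Theorems.FluctuationComparisonRegPrIntLS2BetaPosCollarOfStabiliserLift
import Summits.QuantumFields.YangMills.Theorems.FluctuationComparisonRegPrIntLS2BetaDescentLipschitz
import Summits.QuantumFields.YangMills.Theorems.FluctuationComparisonRegPrIntLS2BetaPosCollarLocalRows
import Summits.QuantumFields.YangMills.Theorems.FluctuationComparisonRegPrIntLS2BetaCriticalELRelated
import Summits.QuantumFields.YangMills.Theorems.FluctuationComparisonRegPrIntLS2BetaIsolOfCriticalOrbitUnique
import Summits.QuantumFields.YangMills.Theorems.FluctuationComparisonRegPrIntLS2BetaTubeRegularSmall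
import Summits.QuantumFields.YangMills.Theorems.FluctuationComparisonRegPrIntLS2BetaTubeGrowthOfIsolated
import Summits.QuantumFields.YangMills.Theorems.FluctuationComparisonRegPrIntLClosedGoodFibre
import HarnessLib

/-!
# S2β · POS∘ ∕ TUBE♭ ∕ GAP♭ — THE (T)-CHAIN's END-TO-END AT **EVERY DATUM WHOSE SYMMETRIES LIFT TO PRINT'S REGULAR MINIMISER**:
# `hcont`, (Lπ)_loc, ISOL∘(δ) and (for small tubes ∕ small `γ`) `hreg` DISCHARGED — seam (b)'s ONE token `hlift`(V,U₀) is the only per-datum letter left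

Cell `ym3-torus` (YM ladder rung R3 = continuum `SU(2)` Yang–Mills on T³ at fixed lattice data — NOT d = 4, NOT infinite volume, NOT a mass gap, NOT Clay).  Width seat
`ym3-torus-px17` (gen 16), FREE px helper of crux `stmt-QuantumFields-20520`; `--supports … --as helper`, count-neutral, DEFINITION-FREE (0 `def`∕`instance`∕`notation`, default heartbeats).

WHY.  ✓px8 g19 (T7-red, II) `…S2BetaPosCollarOfStabiliserLift` proves intrinsic local growth ∕ POS∘ ∕ TUBE♭ at print's regular minimiser `U₀` over ANY datum `V` whose
symmetries lift to symmetries of `U₀` (`hlift` — ✓pen 4 `…S2BetaCriticalOrbitUnique.sameOrbit_of_symmetriesLift_five` :212–213 at `U₀`), displaying besides `hlift` the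
per-datum letters `hcont` ((T2d)), (Lπ)_loc (sup-norm Lipschitz descent at `U₀`) and — for TUBE♭ — ISOL∘(δ).  ✓px21 g19 (T7c)∕(T7e) discharged all of them on the IRREDUCIBLE
stratum (central stabiliser).  THIS FILE does the same at EVERY datum with `hlift`, so that (T7c)∕(T7e) are the special case `hlift ⟸ central stabiliser` (✓px8 (T7-red, I)
`symmetriesLift_of_centralStab`) and the ABELIAN stratum is the special case `hlift ⟸ σ₃-diagonal minimiser` (px12 g21 (B) FILE 3 `symmetriesLift_of_diagonal`):
* `hcont` = ✓(T2d) `eventually_continuousAt_descendTo_of_mem_regFibrePr`; (Lπ)_loc = ✓px13 g20 `…S2BetaDescentLipschitz.exists_threshold_supLipschitz` (+ `exists_ePi`) — as in ✓(T7c) §1;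
* ISOL∘(δ) = ✓px8 `isol_of_atMostOneCriticalOrbit` ∘ Prop. 7 cl. 1, and Prop. 7 cl. 1 at a datum whose symmetries lift to an R2-critical regular point is ✓px17 g15 pen 7
  `atMostOneCriticalOrbit_of_el_symmetriesLift_five` ∘ ✓`Prop7CritEL.deriv_comp_eq_zero_of_isCritR2` (§2) — the SAME token `hlift` serves the POS∘ side and the ISOL∘ side;
* `hreg`(δ) for `δ ≤ δ₀(U₀)` = ✓px16 g18 `…S2BetaTubeRegularSmall.exists_delta_isol_of_atMostOneCriticalOrbit` ∕ `exists_delta_regPr_of_tube` under CL(V) = ✓`…ClosedGoodFibre.exists_gamma_closedGoodFibre`.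
WHAT IS PROVED (all at `L ≥ 5`, thresholds `L`-only, constants PER DATUM):
* §1 ★★★ `growthOn_nhds_at_isCritR2_of_lift_five'` ∕ `posCollar_at_isCritR2_of_lift_five'` ∕ `tubeGrowth_at_isCritR2_of_lift_of_isolated_five'` — (T7-red, II)'s three theorems with
  `hcont` and (Lπ)_loc DISCHARGED: per-datum letters left `hlift` (and ISOL∘(δ) for TUBE♭); threshold `e₉(L) := min e₈ (min e_π (e_π′∕2))`.
* §2 ★★ `atMostOneCriticalOrbit_of_isCritR2_of_lift_five` — PROP. 7 CL. 1 at `(e, V)` ⟸ ONE R2-critical `U₀ ∈ regFibrePr e V` with `hlift`(V,U₀) (pen 7 §4's E–L binder discharged by Fermat).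
* §3 ★★★★ `tubeGrowth_at_isCritR2_of_lift_of_hreg_five` — TUBE♭(V,U₀) ⟸ {`hlift`, `hreg`(δ)}; ★★★★ `tubeGrowth_smallTube_at_isCritR2_of_lift_of_CL_five` — `∃ δ₀ > 0, ∀ δ ≤ δ₀`,
  TUBE♭(V,U₀;δ) ⟸ {`hlift`, CL(V)}.
* §4 ★★★★ `gapFlat_at_min_of_lift_of_hreg_five` — GAP♭(V,U₀) ⟸ {`hlift`, `hreg`(δ)} UNIFORMLY in `γ ≤ γ*(L,b₀,p₀,δ)`; ★★★★ `gapFlat_at_min_of_lift_five` — GAP♭(V,U₀) ⟸ `hlift` ALONE at a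
  per-base-point `γ ≤ γ*(U₀)` (the `IsCritR2` binder discharged: a minimiser over `regFibrePr ε₀ V` is R2-critical, lit ✓`isCritR2_of_isMinOn`; base-point rows = EXW∘'s
  {`U₀ ∈ regFibrePr ε₀ V`, `A U₀ = minActionRegPr ε₀ V`}).
WHAT IT DOES: the per-datum GAP♭ road displays ONE token at EVERY datum — `hlift`(V,U₀) — supplied on the irreducible stratum by (T7-red, I) §2 (so ✓(T7e) = §4 ∘
`symmetriesLift_of_centralStab`), on the abelian stratum by px12 (B) FILE 3.  NOT done: `hlift` at a general reducible datum, the organ's datum-free `δ`∕`γ` and K-uniform `μ`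
(TUBE-REG∘ as registered — RECORD 17gh), GAP♯∘, EXW∘.

HONEST: composition BY NAME over landed theorems; nothing of Bałaban's analysis beyond the cited tree theorems; `hlift` at general reducible data, `hreg` at a general `δ`, TUBE-REG∘'s
uniform order, GAP♯∘, EXW∘, S2β, crux 20520 NOT proved; `L = 3` socket open (EMBARGO-LITE №58); no summit statement is proved by a helper; finite-volume ∕ conditional; rung R3 =
SU(2) YM₃ on T³ — NOT d = 4, NOT infinite volume, NOT a mass gap, NOT Clay; the Yang–Mills mass gap is NOT proved.  No `sorry`, axioms standard.

References: T. Bałaban, CMP **102** (1985) 277–309 [Balaban1985Variational] ((2)–(6) p.278, Thm 1 (8)–(10) p.279, (111) p.294, Prop. 7 and (141)–(143) p.299); CMP **102** (1985)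
255–275 [Balaban1985UV3] ((12)–(13) p.259, (18)–(22) p.260); CMP **98** (1985) 17–51 [Balaban1985Averaging] (Prop. 2 p.26, Prop. 5 p.42); CMP **99** (1985) 75–102 [Balaban1985RegularSpaces] (Lemma 1 p.79, Thm 2 p.83).
-/

set_option autoImplicit false

noncomputable section

namespace Summit.QuantumFields.YangMills.Theorems.FluctuationComparisonRegPrIntLS2BetaGapFlatOfStabiliserLift

open Set Filter Topology Function
open scoped Matrix.Norms.L2Operator
open Literature.MathematicalPhysics.QuantumFieldTheory.Balaban1983to89
open Literature.MathematicalPhysics.QuantumFieldTheory.Balaban1983to89.T3ContinuumYM3Torus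
open Literature.MathematicalPhysics.QuantumFieldTheory.Balaban1983to89.T3UnitLawDensityEML (ℰp)
open Literature.MathematicalPhysics.QuantumFieldTheory.Balaban1983to89.T3UnitScaleTilt
open Literature.MathematicalPhysics.QuantumFieldTheory.Balaban1983to89.T3TiltDescent
open Literature.MathematicalPhysics.QuantumFieldTheory.Balaban1983to89.T3ConstrainedMinimiser (fibre)
open Literature.MathematicalPhysics.QuantumFieldTheory.Balaban1983to89.T3PrintedRegularMinimiser
open Literature.MathematicalPhysics.QuantumFieldTheory.Balaban1983to89.T3PrintedRegularOrbits (descTransf)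
open Literature.MathematicalPhysics.QuantumFieldTheory.Balaban1983to89.T3Thm1Carrier (varProblem3)
open Literature.MathematicalPhysics.QuantumFieldTheory.Balaban1983to89.T3Thm1CarrierNative (IsCritR2 isCritR2_of_isMinOn)
open Literature.MathematicalPhysics.QuantumFieldTheory.Balaban1983to89.T4Continuum
open scoped Literature.MathematicalPhysics.QuantumFieldTheory.Balaban1983to89.T3OrbitAverage
open Summit.QuantumFields.YangMills.Theorems.FluctuationComparisonRegPrIntLS2BetaPosCollarLocalRows (eventually_continuousAt_descendTo_of_mem_regFibrePr)
open Summit.QuantumFields.YangMills.Theorems.FluctuationComparisonRegPrIntLS2BetaDescentLipschitz (exists_ePi exists_threshold_supLipschitz)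
open Summit.QuantumFields.YangMills.Theorems.FluctuationComparisonRegPrIntLS2BetaPosCollarOfStabiliserLift (growthOn_nhds_at_isCritR2_of_lift_five)
open Summit.QuantumFields.YangMills.Theorems.FluctuationComparisonRegPrIntLS2BetaPosCollarOfLocalGrowth (posCollar_of_growthOn_nhds tubeGrowth_of_growthOn_nhds_of_isolated)
open Summit.QuantumFields.YangMills.Theorems.FluctuationComparisonRegPrIntLS2BetaCriticalELRelated (atMostOneCriticalOrbit_of_el_symmetriesLift_five)
open Summit.QuantumFields.YangMills.Theorems.Prop7CritEL (deriv_comp_eq_zero_of_isCritR2 continuousAt_of_differentiableAt_bonds)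
open Summit.QuantumFields.YangMills.Theorems.FluctuationComparisonRegPrIntLS2BetaIsolOfCriticalOrbitUnique (isol_of_atMostOneCriticalOrbit)
open Summit.QuantumFields.YangMills.Theorems.FluctuationComparisonRegPrIntLS2BetaTubeRegularSmall (exists_delta_regPr_of_tube exists_delta_isol_of_atMostOneCriticalOrbit)
open Summit.QuantumFields.YangMills.Theorems.FluctuationComparisonRegPrIntLS2BetaTubeGrowthOfIsolated (gapFlatAt_of_pos_of_isolated_of_closePair)
open Summit.QuantumFields.YangMills.Theorems.FluctuationComparisonRegPrIntLClosedGoodFibre (exists_gamma_closedGoodFibre)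

/-! ## §1 Intrinsic local growth ∕ POS∘ ∕ TUBE♭ at print's regular minimiser over a datum whose symmetries lift: `hcont` and (Lπ)_loc discharged -/

section Lift

/-- ★★★ **INTRINSIC LOCAL GROWTH AT PRINT'S REGULAR MINIMISER OVER A DATUM WHOSE SYMMETRIES LIFT TO IT — `hcont` AND (Lπ)_loc DISCHARGED.**  For every `L ≥ 5` there is
`e₉ > 0` (`min` of pen 3's `e₈` and px13's `e_π`, `e_π′∕2`) such that at every member `(F, J < K)`, every `0 < ε₀ ≤ e₉`, every datum `V`, every R2-critical `U₀ ∈ regFibrePr ε₀ V`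
realising `minActionRegPr ε₀ V` whose stabiliser covers the stabiliser of `V` under descent (`hlift`, ✓pen 4's binder VERBATIM at `U₀`): intrinsic residual-orbit growth holds on a
neighbourhood of `U₀` ((T4) §1's socket, text VERBATIM).  Per-datum letters left: `hlift` only.  ✓(T7-red, II) `growthOn_nhds_at_isCritR2_of_lift_five` ∘ {✓(T2d), ✓px13 (Lπ)_loc}.
[cite: Balaban1985Variational, (2)-(6) p.278, Thm 1 (8)-(10) p.279, (141)-(143) p.299; Balaban1985Averaging, Prop. 2 (52)-(54) p.26, Prop. 5 (157) p.42; Balaban1985RegularSpaces, Thm 2 p.83] -/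
theorem growthOn_nhds_at_isCritR2_of_lift_five' (L : ℕ) (h5 : 5 ≤ L) :
    ∃ e₉ : ℝ, 0 < e₉ ∧
      ∀ (F : T3Family), F.L = L → ∀ (J K : ℕ) (hJK : J < K) (γ b₀ p₀ ε₀ : ℝ)
        (V : GaugeField (F.P J) 0 (Matrix.specialUnitaryGroup (Fin 2) ℂ)) (U₀ : GaugeField (F.P K) 0 (Matrix.specialUnitaryGroup (Fin 2) ℂ)),
        0 < ε₀ → ε₀ ≤ e₉ → U₀ ∈ regFibrePr F J K hJK.le ε₀ V → IsCritR2 F J K hJK.le V U₀ →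
        wilsonAction4 U₀ = minActionRegPr F J K hJK.le ε₀ V →
        (∀ s : GaugeTransf (F.P J) 0 (Matrix.specialUnitaryGroup (Fin 2) ℂ), GaugeField.gaugeAct s V = V →
            ∃ k : GaugeTransf (F.P K) 0 (Matrix.specialUnitaryGroup (Fin 2) ℂ), GaugeField.gaugeAct k U₀ = U₀ ∧ descTransf F J K hJK.le k = s) →
        ∃ N ∈ 𝓝 U₀, ∃ c : ℝ, 0 < c ∧
          ∀ U ∈ closure (fibre F ℰp J K hJK.le V ∩ histGood F ℰp (θBal F.L γ b₀ p₀) K J), U ∈ N →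
            c * (⨅ w : {w : Site (F.P K) 0 → Matrix.specialUnitaryGroup (Fin 2) ℂ |
                  ∀ U : GaugeField (F.P K) 0 (Matrix.specialUnitaryGroup (Fin 2) ℂ),
                    descendTo F ℰp J K hJK.le (GaugeField.gaugeAct w U) = descendTo F ℰp J K hJK.le U},
                ∑ ℓ : PBond (F.P K) 0,
                  dist1 (U ℓ * ((GaugeField.gaugeAct (w : Site (F.P K) 0 → Matrix.specialUnitaryGroup (Fin 2) ℂ) U₀) ℓ)⁻¹) ^ 2)
              ≤ wilsonAction4 U - minActionRegPr F J K hJK.le ε₀ V := by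
  obtain ⟨e₈, he₈, H⟩ := growthOn_nhds_at_isCritR2_of_lift_five L h5
  obtain ⟨eπ, heπ, Hπ⟩ := exists_threshold_supLipschitz L (by omega)
  obtain ⟨eπ', heπ', Hπ'⟩ := exists_ePi L (by omega)
  refine ⟨min e₈ (min eπ (eπ' / 2)), lt_min he₈ (lt_min heπ (by positivity)), ?_⟩
  intro F hF J K hJK γ b₀ p₀ ε₀ V U₀ hε₀ hεe hU₀reg hcrit hmin hlift
  have hε8 : ε₀ ≤ e₈ := hεe.trans (min_le_left _ _)
  have hεπ : ε₀ ≤ eπ := hεe.trans ((min_le_right _ _).trans (min_le_left _ _))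
  have hεπ' : 2 * ε₀ ≤ eπ' := by have := hεe.trans ((min_le_right _ _).trans (min_le_right _ _)); linarith
  obtain ⟨hr3, hr2, -⟩ := Hπ' (2 * ε₀) (by positivity) hεπ'
  rw [← hF] at hr2
  obtain ⟨ρ₀, Kπ, hρ₀, hKπ, hLip⟩ := Hπ F hF J K hJK.le ε₀ hε₀ hεπ V U₀ hU₀reg
  exact H F hF J K hJK ε₀ γ b₀ p₀ ε₀ V U₀ hε₀ hε8 hU₀reg hcrit hmin
    (eventually_continuousAt_descendTo_of_mem_regFibrePr F hJK.le hε₀ hr3 hr2 hU₀reg) hlift ρ₀ Kπ hρ₀ hKπ hLip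

/-- ★★★ **POS∘ AT PRINT'S REGULAR MINIMISER OVER A DATUM WHOSE SYMMETRIES LIFT ⟸ `hlift` ALONE** (`ε₀ ≤ e₉(L)`; px8's `hpos` text VERBATIM, every `δ`) —
✓(T4) `posCollar_of_growthOn_nhds` ∘ §1. [cite: Balaban1985Variational, Thm 1 (8)-(10) p.279, (141)-(143) p.299; Balaban1985UV3, (12)-(13) p.259] -/
theorem posCollar_at_isCritR2_of_lift_five' (L : ℕ) (h5 : 5 ≤ L) :
    ∃ e₉ : ℝ, 0 < e₉ ∧
      ∀ (F : T3Family), F.L = L → ∀ (J K : ℕ) (hJK : J < K) (γ b₀ p₀ ε₀ : ℝ)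
        (V : GaugeField (F.P J) 0 (Matrix.specialUnitaryGroup (Fin 2) ℂ)) (U₀ : GaugeField (F.P K) 0 (Matrix.specialUnitaryGroup (Fin 2) ℂ)) (δ : ℝ),
        0 < ε₀ → ε₀ ≤ e₉ → U₀ ∈ regFibrePr F J K hJK.le ε₀ V → IsCritR2 F J K hJK.le V U₀ →
        wilsonAction4 U₀ = minActionRegPr F J K hJK.le ε₀ V →
        (∀ s : GaugeTransf (F.P J) 0 (Matrix.specialUnitaryGroup (Fin 2) ℂ), GaugeField.gaugeAct s V = V →
            ∃ k : GaugeTransf (F.P K) 0 (Matrix.specialUnitaryGroup (Fin 2) ℂ), GaugeField.gaugeAct k U₀ = U₀ ∧ descTransf F J K hJK.le k = s) →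
        ∃ r c : ℝ, 0 < r ∧ 0 < c ∧
          ∀ U ∈ closure (fibre F ℰp J K hJK.le V ∩ histGood F ℰp (θBal F.L γ b₀ p₀) K J),
            (∃ w : Site (F.P K) 0 → Matrix.specialUnitaryGroup (Fin 2) ℂ,
              (∀ U'' : GaugeField (F.P K) 0 (Matrix.specialUnitaryGroup (Fin 2) ℂ),
                  descendTo F ℰp J K hJK.le (GaugeField.gaugeAct w U'') = descendTo F ℰp J K hJK.le U'') ∧
                ∀ ℓ : PBond (F.P K) 0, dist1 (U ℓ * ((GaugeField.gaugeAct w U₀) ℓ)⁻¹) ≤ δ) →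
            (⨅ w : {w : Site (F.P K) 0 → Matrix.specialUnitaryGroup (Fin 2) ℂ |
                  ∀ U : GaugeField (F.P K) 0 (Matrix.specialUnitaryGroup (Fin 2) ℂ),
                    descendTo F ℰp J K hJK.le (GaugeField.gaugeAct w U) = descendTo F ℰp J K hJK.le U},
                ∑ ℓ : PBond (F.P K) 0,
                  dist1 (U ℓ * ((GaugeField.gaugeAct (w : Site (F.P K) 0 → Matrix.specialUnitaryGroup (Fin 2) ℂ) U₀) ℓ)⁻¹) ^ 2) ≤ r →
            c * (⨅ w : {w : Site (F.P K) 0 → Matrix.specialUnitaryGroup (Fin 2) ℂ |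
                  ∀ U : GaugeField (F.P K) 0 (Matrix.specialUnitaryGroup (Fin 2) ℂ),
                    descendTo F ℰp J K hJK.le (GaugeField.gaugeAct w U) = descendTo F ℰp J K hJK.le U},
                ∑ ℓ : PBond (F.P K) 0,
                  dist1 (U ℓ * ((GaugeField.gaugeAct (w : Site (F.P K) 0 → Matrix.specialUnitaryGroup (Fin 2) ℂ) U₀) ℓ)⁻¹) ^ 2)
              ≤ wilsonAction4 U - minActionRegPr F J K hJK.le ε₀ V := by
  obtain ⟨e₉, he₉, H⟩ := growthOn_nhds_at_isCritR2_of_lift_five' L h5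
  refine ⟨e₉, he₉, ?_⟩
  intro F hF J K hJK γ b₀ p₀ ε₀ V U₀ δ hε₀ hεe hU₀reg hcrit hmin hlift
  obtain ⟨N, hN, c, hc, hgrowN⟩ := H F hF J K hJK γ b₀ p₀ ε₀ V U₀ hε₀ hεe hU₀reg hcrit hmin hlift
  exact posCollar_of_growthOn_nhds F hJK.le V U₀ δ hN hc hgrowN

/-- ★★★ **TUBE♭(V,U₀) AT PRINT'S REGULAR MINIMISER OVER A DATUM WHOSE SYMMETRIES LIFT ⟸ {`hlift`, ISOL∘(δ)}** (ISOL∘ = the `hisol` text VERBATIM; TUBE♭ VERBATIM) —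
✓(T4) `tubeGrowth_of_growthOn_nhds_of_isolated` ∘ §1. [cite: Balaban1985Variational, Thm 1 (8)-(10) p.279, (141)-(143) p.299; Balaban1985UV3, (12)-(13) p.259, (18)-(22) p.260] -/
theorem tubeGrowth_at_isCritR2_of_lift_of_isolated_five' (L : ℕ) (h5 : 5 ≤ L) :
    ∃ e₉ : ℝ, 0 < e₉ ∧
      ∀ (F : T3Family), F.L = L → ∀ (J K : ℕ) (hJK : J < K) (γ b₀ p₀ ε₀ : ℝ)
        (V : GaugeField (F.P J) 0 (Matrix.specialUnitaryGroup (Fin 2) ℂ)) (U₀ : GaugeField (F.P K) 0 (Matrix.specialUnitaryGroup (Fin 2) ℂ)) (δ : ℝ),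
        0 < ε₀ → ε₀ ≤ e₉ → U₀ ∈ regFibrePr F J K hJK.le ε₀ V → IsCritR2 F J K hJK.le V U₀ →
        wilsonAction4 U₀ = minActionRegPr F J K hJK.le ε₀ V →
        (∀ s : GaugeTransf (F.P J) 0 (Matrix.specialUnitaryGroup (Fin 2) ℂ), GaugeField.gaugeAct s V = V →
            ∃ k : GaugeTransf (F.P K) 0 (Matrix.specialUnitaryGroup (Fin 2) ℂ), GaugeField.gaugeAct k U₀ = U₀ ∧ descTransf F J K hJK.le k = s) →
        (∀ U ∈ closure (fibre F ℰp J K hJK.le V ∩ histGood F ℰp (θBal F.L γ b₀ p₀) K J),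
            (∃ w : Site (F.P K) 0 → Matrix.specialUnitaryGroup (Fin 2) ℂ,
              (∀ U'' : GaugeField (F.P K) 0 (Matrix.specialUnitaryGroup (Fin 2) ℂ),
                  descendTo F ℰp J K hJK.le (GaugeField.gaugeAct w U'') = descendTo F ℰp J K hJK.le U'') ∧
                ∀ ℓ : PBond (F.P K) 0, dist1 (U ℓ * ((GaugeField.gaugeAct w U₀) ℓ)⁻¹) ≤ δ) →
            wilsonAction4 U ≤ minActionRegPr F J K hJK.le ε₀ V →
            (⨅ w : {w : Site (F.P K) 0 → Matrix.specialUnitaryGroup (Fin 2) ℂ |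
                  ∀ U : GaugeField (F.P K) 0 (Matrix.specialUnitaryGroup (Fin 2) ℂ),
                    descendTo F ℰp J K hJK.le (GaugeField.gaugeAct w U) = descendTo F ℰp J K hJK.le U},
                ∑ ℓ : PBond (F.P K) 0,
                  dist1 (U ℓ * ((GaugeField.gaugeAct (w : Site (F.P K) 0 → Matrix.specialUnitaryGroup (Fin 2) ℂ) U₀) ℓ)⁻¹) ^ 2) = 0) →
        ∃ μ : ℝ, 0 < μ ∧ ∀ U ∈ fibre F ℰp J K hJK.le V, U ∈ histGood F ℰp (θBal F.L γ b₀ p₀) K J →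
          (∃ w : Site (F.P K) 0 → Matrix.specialUnitaryGroup (Fin 2) ℂ,
              (∀ U'' : GaugeField (F.P K) 0 (Matrix.specialUnitaryGroup (Fin 2) ℂ),
                  descendTo F ℰp J K hJK.le (GaugeField.gaugeAct w U'') = descendTo F ℰp J K hJK.le U'') ∧
                ∀ ℓ : PBond (F.P K) 0, dist1 (U ℓ * ((GaugeField.gaugeAct w U₀) ℓ)⁻¹) ≤ δ) →
          μ * ((F.L : ℝ)⁻¹) ^ (2 * (K - J)) *
              (⨅ w : {w : Site (F.P K) 0 → Matrix.specialUnitaryGroup (Fin 2) ℂ |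
                  ∀ U : GaugeField (F.P K) 0 (Matrix.specialUnitaryGroup (Fin 2) ℂ),
                    descendTo F ℰp J K hJK.le (GaugeField.gaugeAct w U) = descendTo F ℰp J K hJK.le U},
                ∑ ℓ : PBond (F.P K) 0,
                  dist1 (U ℓ * ((GaugeField.gaugeAct (w : Site (F.P K) 0 → Matrix.specialUnitaryGroup (Fin 2) ℂ) U₀) ℓ)⁻¹) ^ 2)
            ≤ wilsonAction4 U - minActionRegPr F J K hJK.le ε₀ V := by
  obtain ⟨e₉, he₉, H⟩ := growthOn_nhds_at_isCritR2_of_lift_five' L h5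
  refine ⟨e₉, he₉, ?_⟩
  intro F hF J K hJK γ b₀ p₀ ε₀ V U₀ δ hε₀ hεe hU₀reg hcrit hmin hlift hisol
  obtain ⟨N, hN, c, hc, hgrowN⟩ := H F hF J K hJK γ b₀ p₀ ε₀ V U₀ hε₀ hεe hU₀reg hcrit hmin hlift
  exact tubeGrowth_of_growthOn_nhds_of_isolated F hJK.le V U₀ δ hN hc hgrowN hisol

end Lift

/-! ## §2 Prop. 7 clause 1 at a datum whose symmetries lift to an R2-critical regular point -/

section PropSeven

/-- ★★ **PROP. 7 CLAUSE 1 AT `(e, V)` FROM ONE R2-CRITICAL REGULAR POINT WHOSE DATUM-SYMMETRIES LIFT TO IT.**  For every `L ≥ 5` there is `e₈ > 0` (pen 7's) such that at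
every member `(F, J < K)`, every `0 < e ≤ e₈` and every datum `V`: if some `U₀ ∈ regFibrePr e V` is R2-critical and every symmetry of `V` lifts to a symmetry of `U₀` (`hlift`),
then `(varProblem3 F J K hJK.le).AtMostOneCriticalOrbit e V`.  ✓pen 7 `atMostOneCriticalOrbit_of_el_symmetriesLift_five` with its E–L binder at `U₀` discharged by Fermat on the
open regular class (✓`Prop7CritEL.deriv_comp_eq_zero_of_isCritR2` ∘ `continuousAt_of_differentiableAt_bonds`).
[cite: Balaban1985Variational, (4)-(6) p.278, Thm 1 (8)-(10) p.279, (111) p.294, Prop. 7 and (141)-(143) p.299] -/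
theorem atMostOneCriticalOrbit_of_isCritR2_of_lift_five (L : ℕ) (h5 : 5 ≤ L) :
    ∃ e₈ : ℝ, 0 < e₈ ∧
      ∀ (F : T3Family), F.L = L → ∀ (J K : ℕ) (hJK : J < K) (e : ℝ)
        (V : GaugeField (F.P J) 0 (Matrix.specialUnitaryGroup (Fin 2) ℂ)) (U₀ : GaugeField (F.P K) 0 (Matrix.specialUnitaryGroup (Fin 2) ℂ)),
        0 < e → e ≤ e₈ → U₀ ∈ regFibrePr F J K hJK.le e V → IsCritR2 F J K hJK.le V U₀ →
        (∀ s : GaugeTransf (F.P J) 0 (Matrix.specialUnitaryGroup (Fin 2) ℂ), GaugeField.gaugeAct s V = V →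
            ∃ k : GaugeTransf (F.P K) 0 (Matrix.specialUnitaryGroup (Fin 2) ℂ), GaugeField.gaugeAct k U₀ = U₀ ∧ descTransf F J K hJK.le k = s) →
        (varProblem3 F J K hJK.le).AtMostOneCriticalOrbit e V := by
  obtain ⟨e₈, he₈, H⟩ := atMostOneCriticalOrbit_of_el_symmetriesLift_five L h5
  refine ⟨e₈, he₈, ?_⟩
  intro F hF J K hJK e V U₀ he hee hU₀reg hcrit hlift
  exact H F hF J K hJK e V he hee
    ⟨U₀, hU₀reg, fun γ hγ0 hγfib hγd => deriv_comp_eq_zero_of_isCritR2 hcrit γ hγ0 hγfib (continuousAt_of_differentiableAt_bonds γ hγd), hlift⟩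

end PropSeven

/-! ## §3 ISOL∘(δ) discharged: TUBE♭ from `hlift` and the tube-regularity row, and for every small tube from `hlift` and CL(V) -/

section Isol

/-- ★★★★ **TUBE♭(V,U₀) AT PRINT'S REGULAR MINIMISER OVER A DATUM WHOSE SYMMETRIES LIFT ⟸ {`hlift`, `hreg`(δ)} — ISOL∘(δ) DISCHARGED.**  For every `L ≥ 5` there is `e₉ > 0`
(`min` of §1's threshold and pen 7's `e₈`) such that at every member `(F, J < K)`, every `0 < ε₀ ≤ e₉`, every datum `V`, every R2-critical `U₀ ∈ regFibrePr ε₀ V` realising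
`minActionRegPr ε₀ V` with `hlift`(V,U₀), and every tube radius `δ` for which the tube minimisers of the closed good fibre are `ε₀`-regular (`hreg` — ✓px8's binder VERBATIM),
TUBE♭(V,U₀) holds (text VERBATIM).  Composition: §1 ∘ ✓px8 `isol_of_atMostOneCriticalOrbit` ∘ §2.
[cite: Balaban1985Variational, (4)-(6) p.278, Thm 1 (8)-(10) p.279, Prop. 7 and (141)-(143) p.299; Balaban1985UV3, (12)-(13) p.259 and (18)-(22) p.260] -/
theorem tubeGrowth_at_isCritR2_of_lift_of_hreg_five (L : ℕ) (h5 : 5 ≤ L) :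
    ∃ e₉ : ℝ, 0 < e₉ ∧
      ∀ (F : T3Family), F.L = L → ∀ (J K : ℕ) (hJK : J < K) (γ b₀ p₀ ε₀ : ℝ)
        (V : GaugeField (F.P J) 0 (Matrix.specialUnitaryGroup (Fin 2) ℂ)) (U₀ : GaugeField (F.P K) 0 (Matrix.specialUnitaryGroup (Fin 2) ℂ)) (δ : ℝ),
        0 < ε₀ → ε₀ ≤ e₉ → U₀ ∈ regFibrePr F J K hJK.le ε₀ V → IsCritR2 F J K hJK.le V U₀ →
        wilsonAction4 U₀ = minActionRegPr F J K hJK.le ε₀ V →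
        (∀ s : GaugeTransf (F.P J) 0 (Matrix.specialUnitaryGroup (Fin 2) ℂ), GaugeField.gaugeAct s V = V →
            ∃ k : GaugeTransf (F.P K) 0 (Matrix.specialUnitaryGroup (Fin 2) ℂ), GaugeField.gaugeAct k U₀ = U₀ ∧ descTransf F J K hJK.le k = s) →
        (∀ U ∈ closure (fibre F ℰp J K hJK.le V ∩ histGood F ℰp (θBal F.L γ b₀ p₀) K J),
            (∃ w : Site (F.P K) 0 → Matrix.specialUnitaryGroup (Fin 2) ℂ,
              (∀ U'' : GaugeField (F.P K) 0 (Matrix.specialUnitaryGroup (Fin 2) ℂ),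
                  descendTo F ℰp J K hJK.le (GaugeField.gaugeAct w U'') = descendTo F ℰp J K hJK.le U'') ∧
                ∀ ℓ : PBond (F.P K) 0, dist1 (U ℓ * ((GaugeField.gaugeAct w U₀) ℓ)⁻¹) ≤ δ) →
            wilsonAction4 U ≤ minActionRegPr F J K hJK.le ε₀ V → U ∈ regFibrePr F J K hJK.le ε₀ V) →
        ∃ μ : ℝ, 0 < μ ∧ ∀ U ∈ fibre F ℰp J K hJK.le V, U ∈ histGood F ℰp (θBal F.L γ b₀ p₀) K J →
          (∃ w : Site (F.P K) 0 → Matrix.specialUnitaryGroup (Fin 2) ℂ,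
              (∀ U'' : GaugeField (F.P K) 0 (Matrix.specialUnitaryGroup (Fin 2) ℂ),
                  descendTo F ℰp J K hJK.le (GaugeField.gaugeAct w U'') = descendTo F ℰp J K hJK.le U'') ∧
                ∀ ℓ : PBond (F.P K) 0, dist1 (U ℓ * ((GaugeField.gaugeAct w U₀) ℓ)⁻¹) ≤ δ) →
          μ * ((F.L : ℝ)⁻¹) ^ (2 * (K - J)) *
              (⨅ w : {w : Site (F.P K) 0 → Matrix.specialUnitaryGroup (Fin 2) ℂ |
                  ∀ U : GaugeField (F.P K) 0 (Matrix.specialUnitaryGroup (Fin 2) ℂ),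
                    descendTo F ℰp J K hJK.le (GaugeField.gaugeAct w U) = descendTo F ℰp J K hJK.le U},
                ∑ ℓ : PBond (F.P K) 0,
                  dist1 (U ℓ * ((GaugeField.gaugeAct (w : Site (F.P K) 0 → Matrix.specialUnitaryGroup (Fin 2) ℂ) U₀) ℓ)⁻¹) ^ 2)
            ≤ wilsonAction4 U - minActionRegPr F J K hJK.le ε₀ V := by
  obtain ⟨e₈, he₈, H⟩ := tubeGrowth_at_isCritR2_of_lift_of_isolated_five' L h5
  obtain ⟨e₈', he₈', H1⟩ := atMostOneCriticalOrbit_of_isCritR2_of_lift_five L h5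
  refine ⟨min e₈ e₈', lt_min he₈ he₈', ?_⟩
  intro F hF J K hJK γ b₀ p₀ ε₀ V U₀ δ hε₀ hεe hU₀reg hcrit hmin hlift hreg
  have h1 := H1 F hF J K hJK ε₀ V U₀ hε₀ (hεe.trans (min_le_right _ _)) hU₀reg hcrit hlift
  exact H F hF J K hJK γ b₀ p₀ ε₀ V U₀ δ hε₀ (hεe.trans (min_le_left _ _)) hU₀reg hcrit hmin hlift
    (isol_of_atMostOneCriticalOrbit F hJK.le hε₀ V U₀ δ h1 hU₀reg hmin hreg)

/-- ★★★★ **TUBE♭(V,U₀) FOR EVERY SMALL TUBE RADIUS AT PRINT'S REGULAR MINIMISER OVER A DATUM WHOSE SYMMETRIES LIFT ⟸ {`hlift`, CL(V)} — `hreg` DISCHARGED TOO**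
(✓px16 g18 `exists_delta_isol_of_atMostOneCriticalOrbit`).  For every `L ≥ 5` there is `e₉ > 0` such that at every member `(F, J < K)`, every `0 < ε₀ ≤ e₉`, every datum `V`,
every R2-critical `U₀ ∈ regFibrePr ε₀ V` realising `minActionRegPr ε₀ V` with `hlift`(V,U₀), under CL(V) (`closure (fibre V ∩ histGood) ⊆ fibre V` — ✓`exists_gamma_closedGoodFibre`,
`γ ≤ γ_CL`): `∃ δ₀ > 0, ∀ δ ≤ δ₀`, TUBE♭(V,U₀;δ) (text VERBATIM).  `δ₀` is per base point — NOT the organ's datum-free `δ` (TUBE-REG∘ stays open).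
[cite: Balaban1985Variational, (4)-(6) p.278, Thm 1 (8)-(10) p.279, Prop. 7 and (141)-(143) p.299; Balaban1985UV3, (12)-(13) p.259 and (18)-(22) p.260] -/
theorem tubeGrowth_smallTube_at_isCritR2_of_lift_of_CL_five (L : ℕ) (h5 : 5 ≤ L) :
    ∃ e₉ : ℝ, 0 < e₉ ∧
      ∀ (F : T3Family), F.L = L → ∀ (J K : ℕ) (hJK : J < K) (γ b₀ p₀ ε₀ : ℝ)
        (V : GaugeField (F.P J) 0 (Matrix.specialUnitaryGroup (Fin 2) ℂ)) (U₀ : GaugeField (F.P K) 0 (Matrix.specialUnitaryGroup (Fin 2) ℂ)),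
        0 < ε₀ → ε₀ ≤ e₉ → U₀ ∈ regFibrePr F J K hJK.le ε₀ V → IsCritR2 F J K hJK.le V U₀ →
        wilsonAction4 U₀ = minActionRegPr F J K hJK.le ε₀ V →
        (∀ s : GaugeTransf (F.P J) 0 (Matrix.specialUnitaryGroup (Fin 2) ℂ), GaugeField.gaugeAct s V = V →
            ∃ k : GaugeTransf (F.P K) 0 (Matrix.specialUnitaryGroup (Fin 2) ℂ), GaugeField.gaugeAct k U₀ = U₀ ∧ descTransf F J K hJK.le k = s) →
        closure (fibre F ℰp J K hJK.le V ∩ histGood F ℰp (θBal F.L γ b₀ p₀) K J) ⊆ fibre F ℰp J K hJK.le V →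
        ∃ δ₀ : ℝ, 0 < δ₀ ∧ ∀ δ : ℝ, δ ≤ δ₀ →
        ∃ μ : ℝ, 0 < μ ∧ ∀ U ∈ fibre F ℰp J K hJK.le V, U ∈ histGood F ℰp (θBal F.L γ b₀ p₀) K J →
          (∃ w : Site (F.P K) 0 → Matrix.specialUnitaryGroup (Fin 2) ℂ,
              (∀ U'' : GaugeField (F.P K) 0 (Matrix.specialUnitaryGroup (Fin 2) ℂ),
                  descendTo F ℰp J K hJK.le (GaugeField.gaugeAct w U'') = descendTo F ℰp J K hJK.le U'') ∧
                ∀ ℓ : PBond (F.P K) 0, dist1 (U ℓ * ((GaugeField.gaugeAct w U₀) ℓ)⁻¹) ≤ δ) →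
          μ * ((F.L : ℝ)⁻¹) ^ (2 * (K - J)) *
              (⨅ w : {w : Site (F.P K) 0 → Matrix.specialUnitaryGroup (Fin 2) ℂ |
                  ∀ U : GaugeField (F.P K) 0 (Matrix.specialUnitaryGroup (Fin 2) ℂ),
                    descendTo F ℰp J K hJK.le (GaugeField.gaugeAct w U) = descendTo F ℰp J K hJK.le U},
                ∑ ℓ : PBond (F.P K) 0,
                  dist1 (U ℓ * ((GaugeField.gaugeAct (w : Site (F.P K) 0 → Matrix.specialUnitaryGroup (Fin 2) ℂ) U₀) ℓ)⁻¹) ^ 2)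
            ≤ wilsonAction4 U - minActionRegPr F J K hJK.le ε₀ V := by
  obtain ⟨e₈, he₈, H⟩ := tubeGrowth_at_isCritR2_of_lift_of_isolated_five' L h5
  obtain ⟨e₈', he₈', H1⟩ := atMostOneCriticalOrbit_of_isCritR2_of_lift_five L h5
  refine ⟨min e₈ e₈', lt_min he₈ he₈', ?_⟩
  intro F hF J K hJK γ b₀ p₀ ε₀ V U₀ hε₀ hεe hU₀reg hcrit hmin hlift hCL
  have h1 := H1 F hF J K hJK ε₀ V U₀ hε₀ (hεe.trans (min_le_right _ _)) hU₀reg hcrit hlift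
  obtain ⟨δ₀, hδ₀, hisol⟩ := exists_delta_isol_of_atMostOneCriticalOrbit F hJK.le hε₀ V U₀ h1 hU₀reg hmin hCL
  refine ⟨δ₀, hδ₀, fun δ hδ => ?_⟩
  exact H F hF J K hJK γ b₀ p₀ ε₀ V U₀ δ hε₀ (hεe.trans (min_le_left _ _)) hU₀reg hcrit hmin hlift (hisol δ hδ)

end Isol

/-! ## §4 GAP♭ at print's regular minimiser from `hlift`: with the tube-regularity row (uniform `γ*`), and from `hlift` ALONE (per-base-point `γ*`) -/

section Gap

/-- ★★★★ **GAP♭(V,U₀) AT PRINT'S REGULAR MINIMISER OVER A DATUM WHOSE SYMMETRIES LIFT ⟸ {`hlift`, `hreg`(δ)}, UNIFORMLY IN `γ ≤ γ*(L,b₀,p₀,δ)`.**  For every `L ≥ 5`,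
`b₀, p₀ > 0` and tube radius `δ > 0` there are `e₉ > 0` (§1's and pen 7's thresholds) and `γ* > 0` (the door's `γ₁(δ)`) such that at every member `(F, γ ≤ γ*, J < K)`, every
`0 < ε₀ ≤ e₉`, every datum `V`, every good history `U₀ ∈ regFibrePr ε₀ V` realising `minActionRegPr ε₀ V` (hence R2-critical, lit ✓`isCritR2_of_isMinOn`) with `hlift`(V,U₀), under the
tube-regularity row `hreg`(δ) (✓px8's binder VERBATIM): GAP♭(V,U₀) (the (T3) dock's text VERBATIM).  Composition: ✓`gapFlatAt_of_pos_of_isolated_of_closePair` ∘ {§1 POS∘, ✓px8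
`isol_of_atMostOneCriticalOrbit` ∘ §2}.  ✓(T7e) §1 is the case `hlift ⟸ central stabiliser`.
[cite: Balaban1985Variational, (4)-(6) p.278, Thm 1 (8)-(10) p.279, Prop. 7 and (141)-(143) p.299; Balaban1985UV3, (12)-(13) p.259 and (18)-(22) p.260; Balaban1985RegularSpaces, Lemma 1 (1.24)-(1.26) p.79] -/
theorem gapFlat_at_min_of_lift_of_hreg_five (L : ℕ) (h5 : 5 ≤ L) (b₀ p₀ : ℝ) (hb : 0 < b₀) (hp : 0 < p₀) (δ : ℝ) (hδ : 0 < δ) :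
    ∃ e₉ γs : ℝ, 0 < e₉ ∧ 0 < γs ∧
      ∀ (F : T3Family) (γ : ℝ), F.L = L → 0 < γ → γ ≤ γs → ∀ (J K : ℕ) (hJK : J < K) (ε₀ : ℝ)
        (V : GaugeField (F.P J) 0 (Matrix.specialUnitaryGroup (Fin 2) ℂ)) (U₀ : GaugeField (F.P K) 0 (Matrix.specialUnitaryGroup (Fin 2) ℂ)),
        0 < ε₀ → ε₀ ≤ e₉ → U₀ ∈ regFibrePr F J K hJK.le ε₀ V →
        wilsonAction4 U₀ = minActionRegPr F J K hJK.le ε₀ V → U₀ ∈ histGood F ℰp (θBal F.L γ b₀ p₀) K J →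
        (∀ s : GaugeTransf (F.P J) 0 (Matrix.specialUnitaryGroup (Fin 2) ℂ), GaugeField.gaugeAct s V = V →
            ∃ k : GaugeTransf (F.P K) 0 (Matrix.specialUnitaryGroup (Fin 2) ℂ), GaugeField.gaugeAct k U₀ = U₀ ∧ descTransf F J K hJK.le k = s) →
        (∀ U ∈ closure (fibre F ℰp J K hJK.le V ∩ histGood F ℰp (θBal F.L γ b₀ p₀) K J),
            (∃ w : Site (F.P K) 0 → Matrix.specialUnitaryGroup (Fin 2) ℂ,
              (∀ U'' : GaugeField (F.P K) 0 (Matrix.specialUnitaryGroup (Fin 2) ℂ),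
                  descendTo F ℰp J K hJK.le (GaugeField.gaugeAct w U'') = descendTo F ℰp J K hJK.le U'') ∧
                ∀ ℓ : PBond (F.P K) 0, dist1 (U ℓ * ((GaugeField.gaugeAct w U₀) ℓ)⁻¹) ≤ δ) →
            wilsonAction4 U ≤ minActionRegPr F J K hJK.le ε₀ V → U ∈ regFibrePr F J K hJK.le ε₀ V) →
        ∃ μ : ℝ, 0 < μ ∧ ∀ U ∈ fibre F ℰp J K hJK.le V, U ∈ histGood F ℰp (θBal F.L γ b₀ p₀) K J →
          μ * ((F.L : ℝ)⁻¹) ^ (2 * (K - J)) *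
              (⨅ w : {w : Site (F.P K) 0 → Matrix.specialUnitaryGroup (Fin 2) ℂ |
                  ∀ U : GaugeField (F.P K) 0 (Matrix.specialUnitaryGroup (Fin 2) ℂ),
                    descendTo F ℰp J K hJK.le (GaugeField.gaugeAct w U) = descendTo F ℰp J K hJK.le U},
                ∑ ℓ : PBond (F.P K) 0,
                  dist1 (U ℓ * ((GaugeField.gaugeAct (w : Site (F.P K) 0 → Matrix.specialUnitaryGroup (Fin 2) ℂ) U₀) ℓ)⁻¹) ^ 2)
            ≤ wilsonAction4 U - minActionRegPr F J K hJK.le ε₀ V := by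
  obtain ⟨e₈, he₈, HP⟩ := posCollar_at_isCritR2_of_lift_five' L h5
  obtain ⟨e₈', he₈', H1⟩ := atMostOneCriticalOrbit_of_isCritR2_of_lift_five L h5
  obtain ⟨γ₁, hγ₁, HG⟩ := gapFlatAt_of_pos_of_isolated_of_closePair L b₀ p₀ hb hp δ hδ
  refine ⟨min e₈ e₈', γ₁, lt_min he₈ he₈', hγ₁, ?_⟩
  intro F γ hF hγ hγle J K hJK ε₀ V U₀ hε₀ hεe hU₀reg hmin hU₀h hlift hreg
  have hU₀fib : U₀ ∈ fibre F ℰp J K hJK.le V := ((mem_regFibrePr_iff F).1 hU₀reg).1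
  have hcrit : IsCritR2 F J K hJK.le V U₀ :=
    isCritR2_of_isMinOn hε₀ hU₀reg (isMinOn_iff.mpr fun W hW => hmin.trans_le (minActionRegPr_le F hW))
  have hpos := HP F hF J K hJK γ b₀ p₀ ε₀ V U₀ δ hε₀ (hεe.trans (min_le_left _ _)) hU₀reg hcrit hmin hlift
  have h1 := H1 F hF J K hJK ε₀ V U₀ hε₀ (hεe.trans (min_le_right _ _)) hU₀reg hcrit hlift
  have hisol := isol_of_atMostOneCriticalOrbit F hJK.le hε₀ V U₀ δ h1 hU₀reg hmin hreg
  exact HG F γ hF hγ hγle J K hJK.le ε₀ V U₀ hU₀fib hU₀h hpos hisol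

/-- ★★★★ **GAP♭(V,U₀) AT PRINT'S REGULAR MINIMISER OVER A DATUM WHOSE SYMMETRIES LIFT ⟸ `hlift` ALONE, for all `γ ≤ γ*(U₀)`.**  For every `L ≥ 5` and `b₀, p₀ > 0` there is
`e₉ > 0` such that at every member `(F, J < K)`, every `0 < ε₀ ≤ e₉`, every datum `V` and every `U₀ ∈ regFibrePr ε₀ V` realising `minActionRegPr ε₀ V` (hence R2-critical) with
`hlift`(V,U₀), there is `γ* > 0` with: for every `0 < γ ≤ γ*` such that `U₀` is a good history, GAP♭(V,U₀) (VERBATIM).  The `hreg` row of `gapFlat_at_min_of_lift_of_hreg_five` is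
discharged at the tube radius `δ₀(U₀)` of ✓px16 `exists_delta_regPr_of_tube` together with CL(V) from ✓`exists_gamma_closedGoodFibre` (`γ ≤ γ_CL(L,b₀,p₀)`); `γ* := min γ_CL γ₁(δ₀)`.
NO per-datum letter remains besides `hlift`; the price is the per-base-point `γ*`.  ✓(T7e) §2 is the case `hlift ⟸ central stabiliser`; px12 (B) FILE 3 supplies `hlift` at abelian data.
[cite: Balaban1985Variational, (4)-(6) p.278, Thm 1 (8)-(10) p.279, Prop. 7 and (141)-(143) p.299; Balaban1985UV3, (12)-(13) p.259 and (18)-(22) p.260; Balaban1985RegularSpaces, Lemma 1 (1.24)-(1.26) p.79] -/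
theorem gapFlat_at_min_of_lift_five (L : ℕ) (h5 : 5 ≤ L) (b₀ p₀ : ℝ) (hb : 0 < b₀) (hp : 0 < p₀) :
    ∃ e₉ : ℝ, 0 < e₉ ∧
      ∀ (F : T3Family), F.L = L → ∀ (J K : ℕ) (hJK : J < K) (ε₀ : ℝ)
        (V : GaugeField (F.P J) 0 (Matrix.specialUnitaryGroup (Fin 2) ℂ)) (U₀ : GaugeField (F.P K) 0 (Matrix.specialUnitaryGroup (Fin 2) ℂ)),
        0 < ε₀ → ε₀ ≤ e₉ → U₀ ∈ regFibrePr F J K hJK.le ε₀ V →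
        wilsonAction4 U₀ = minActionRegPr F J K hJK.le ε₀ V →
        (∀ s : GaugeTransf (F.P J) 0 (Matrix.specialUnitaryGroup (Fin 2) ℂ), GaugeField.gaugeAct s V = V →
            ∃ k : GaugeTransf (F.P K) 0 (Matrix.specialUnitaryGroup (Fin 2) ℂ), GaugeField.gaugeAct k U₀ = U₀ ∧ descTransf F J K hJK.le k = s) →
        ∃ γs : ℝ, 0 < γs ∧ ∀ (γ : ℝ), 0 < γ → γ ≤ γs → U₀ ∈ histGood F ℰp (θBal F.L γ b₀ p₀) K J →
        ∃ μ : ℝ, 0 < μ ∧ ∀ U ∈ fibre F ℰp J K hJK.le V, U ∈ histGood F ℰp (θBal F.L γ b₀ p₀) K J →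
          μ * ((F.L : ℝ)⁻¹) ^ (2 * (K - J)) *
              (⨅ w : {w : Site (F.P K) 0 → Matrix.specialUnitaryGroup (Fin 2) ℂ |
                  ∀ U : GaugeField (F.P K) 0 (Matrix.specialUnitaryGroup (Fin 2) ℂ),
                    descendTo F ℰp J K hJK.le (GaugeField.gaugeAct w U) = descendTo F ℰp J K hJK.le U},
                ∑ ℓ : PBond (F.P K) 0,
                  dist1 (U ℓ * ((GaugeField.gaugeAct (w : Site (F.P K) 0 → Matrix.specialUnitaryGroup (Fin 2) ℂ) U₀) ℓ)⁻¹) ^ 2)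
            ≤ wilsonAction4 U - minActionRegPr F J K hJK.le ε₀ V := by
  obtain ⟨e₈, he₈, HP⟩ := posCollar_at_isCritR2_of_lift_five' L h5
  obtain ⟨e₈', he₈', H1⟩ := atMostOneCriticalOrbit_of_isCritR2_of_lift_five L h5
  obtain ⟨γCL, hγCL, -, HCL⟩ := exists_gamma_closedGoodFibre L (b₀ := b₀) (p₀ := p₀) hb hp
  refine ⟨min e₈ e₈', lt_min he₈ he₈', ?_⟩
  intro F hF J K hJK ε₀ V U₀ hε₀ hεe hU₀reg hmin hlift
  have hU₀fib : U₀ ∈ fibre F ℰp J K hJK.le V := ((mem_regFibrePr_iff F).1 hU₀reg).1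
  have hcrit : IsCritR2 F J K hJK.le V U₀ :=
    isCritR2_of_isMinOn hε₀ hU₀reg (isMinOn_iff.mpr fun W hW => hmin.trans_le (minActionRegPr_le F hW))
  have hU₀R : RegPr F J K ε₀ U₀ := ((mem_regFibrePr_iff F).1 hU₀reg).2
  -- the `γ`-free tube radius of the regular class at `U₀`
  obtain ⟨δ₀, hδ₀, Hreg⟩ := exists_delta_regPr_of_tube F hε₀.le hU₀R
  obtain ⟨γ₁, hγ₁, HG⟩ := gapFlatAt_of_pos_of_isolated_of_closePair L b₀ p₀ hb hp δ₀ hδ₀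
  refine ⟨min γCL γ₁, lt_min hγCL hγ₁, fun γ hγ hγle hU₀h => ?_⟩
  have hCL := HCL F γ hF hγ (hγle.trans (min_le_left _ _)) J K hJK.le V
  -- `hreg` at `δ₀`
  have hreg : ∀ U ∈ closure (fibre F ℰp J K hJK.le V ∩ histGood F ℰp (θBal F.L γ b₀ p₀) K J),
      (∃ w : Site (F.P K) 0 → Matrix.specialUnitaryGroup (Fin 2) ℂ,
        (∀ U'' : GaugeField (F.P K) 0 (Matrix.specialUnitaryGroup (Fin 2) ℂ),
            descendTo F ℰp J K hJK.le (GaugeField.gaugeAct w U'') = descendTo F ℰp J K hJK.le U'') ∧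
          ∀ ℓ : PBond (F.P K) 0, dist1 (U ℓ * ((GaugeField.gaugeAct w U₀) ℓ)⁻¹) ≤ δ₀) →
      wilsonAction4 U ≤ minActionRegPr F J K hJK.le ε₀ V → U ∈ regFibrePr F J K hJK.le ε₀ V := by
    intro U hU hw _
    obtain ⟨w, -, hwℓ⟩ := hw
    exact (mem_regFibrePr_iff F).2 ⟨hCL hU, Hreg w U hwℓ⟩
  have hpos := HP F hF J K hJK γ b₀ p₀ ε₀ V U₀ δ₀ hε₀ (hεe.trans (min_le_left _ _)) hU₀reg hcrit hmin hlift
  have h1 := H1 F hF J K hJK ε₀ V U₀ hε₀ (hεe.trans (min_le_right _ _)) hU₀reg hcrit hlift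
  have hisol := isol_of_atMostOneCriticalOrbit F hJK.le hε₀ V U₀ δ₀ h1 hU₀reg hmin hreg
  exact HG F γ hF hγ (hγle.trans (min_le_right _ _)) J K hJK.le ε₀ V U₀ hU₀fib hU₀h hpos hisol

end Gap

end Summit.QuantumFields.YangMills.Theorems.FluctuationComparisonRegPrIntLS2BetaGapFlatOfStabiliserLift

end
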